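import Summits.FinalStateConjecture.FinalStateConjecture.Theorems.PhotonSphereChannelsCauchyWaveGlobal

/-!
# Crux `WindowedShellChannels` (stmt-FinalStateConjecture-14085), line `SketchIdeator3` —
# partner calculus for the odd escape stub `stub_escapeOdd`

Support file (`--supports`, no definitions).  The registered stub `stub_escapeOdd` asks, for every
time-ODD finite-energy Regge–Wheeler solution `ψ` (data `(0, g)`, `g = ψ_t(0, ·)`) supported off the
shell, for a finite-energy PARTNER solution `φ` with energy pairing `⟨φ, ψ⟩_E(0) = E(ψ)`,
`E(φ) ≤ A·E(ψ)` and forward loss behind the lagged cone `≤ θ²E(ψ)`.  This file proves the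
bookkeeping around that statement (sub-namespace `EscapeOdd`):

* odd solutions: `ψ(0, ·) ≡ 0`, `e[ψ](0, x) = g(x)²`, `E(ψ)(0) = ∫⁻ g²`, support = support of `g`;
* **pairing is automatic**: for ANY `φ` with `φ_t(0, ·) = g` the pairing density at `t = 0` IS
  `e[ψ](0, ·)` pointwise, so `∫ pairing = (E(ψ)(0)).toReal` (`integral_pairing_of_velocity`); the
  same for the trivial partner `φ = ψ` of any solution (`integral_pairing_self`);
* **partners exist** for every `C²` position profile `φ₀` (`oddPartner_exists`, from the global
  Cauchy theorem `CauchyWaveGlobal.stub_rwGlobalCauchy`; `g` is `C¹`), with the energy splitting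
  `E(φ)(0) = E(ψ)(0) + ∫⁻ (φ₀′² + Vφ₀²)` (`totalEnergy_partner_eq`);
* **the two reductions**: `escape_of_core` — the partner conditions with `φ = ψ`, `A = 1`,
  `θ = √(1 − c)` follow from a windowed inequality `c·E(ψ) ≤ caught⁺(ψ)` (so the escape stubs are
  EQUIVALENT to the cores, converse of the skeleton's glue `core_of_duality_escape`), and
  `escapeOdd_of_velocityMatched` — `stub_escapeOdd` follows from its PROFILE FORM: a
  velocity-matched Regge–Wheeler solution `φ` (`φ_t(0, ·) = g`) whose position profile has static
  energy `∫⁻ (φ(0)′² + Vφ(0)²) ≤ A·E(ψ)` and which loses at most `θ²E(ψ)`.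

[folklore]
-/

noncomputable section

set_option linter.dupNamespace false

namespace Summit.FinalStateConjecture.FinalStateConjecture.Theorems.WindowedShellChannelsStubs

open Literature.Geometry.Lorentzian Literature.Geometry.Lorentzian.ReggeWheeler
open Filter Set MeasureTheory
open scoped ENNReal Topology

namespace EscapeOdd

variable {V : ℝ → ℝ} {ψ φ : ℝ → ℝ → ℝ}

/-! ### Slices, continuity, integrals of the energy density -/

/-- The `t`-derivative slice `x ↦ ψ_t(t, x)` of a `C²` function is continuous. [folklore] -/
theorem continuous_deriv_slice_fst (hψ : ContDiff ℝ 2 (Function.uncurry ψ)) (t : ℝ) :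
    Continuous (fun x => deriv (fun τ => ψ τ x) t) := by
  rw [show (fun x => deriv (fun τ => ψ τ x) t) = fun x => fderiv ℝ (Function.uncurry ψ) (t, x) (1, 0)
    from funext fun x => WaveEnergy.deriv_slice_fst_eq hψ t x]
  exact (WaveEnergy.continuous_fderiv_apply hψ (1, 0)).comp (Continuous.prodMk_right t)

/-- The `t`-derivative slice `x ↦ ψ_t(t, x)` of a `C²` function is `C¹` (cf.
`WindowedShellChannelsSplit.contDiff_one_velocityDatum`). [folklore] -/
theorem contDiff_one_deriv_slice_fst (hψ : ContDiff ℝ 2 (Function.uncurry ψ)) (t : ℝ) :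
    ContDiff ℝ 1 (fun x => deriv (fun τ => ψ τ x) t) := by
  rw [show (fun x => deriv (fun τ => ψ τ x) t) = fun x => fderiv ℝ (Function.uncurry ψ) (t, x) (1, 0)
    from funext fun x => WaveEnergy.deriv_slice_fst_eq hψ t x]
  exact ((hψ.fderiv_right (m := 1) (by norm_num)).comp
    (contDiff_const.prodMk contDiff_id)).clm_apply contDiff_const

/-- The `x`-derivative slice `x ↦ ψ_x(t, x)` of a `C²` function is continuous. [folklore] -/
theorem continuous_deriv_slice_snd (hψ : ContDiff ℝ 2 (Function.uncurry ψ)) (t : ℝ) :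
    Continuous (fun x => deriv (ψ t) x) := by
  rw [show (fun x => deriv (ψ t) x) = fun x => fderiv ℝ (Function.uncurry ψ) (t, x) (0, 1)
    from funext fun x => WaveEnergy.deriv_slice_snd_eq hψ t x]
  exact (WaveEnergy.continuous_fderiv_apply hψ (0, 1)).comp (Continuous.prodMk_right t)

/-- `x`-slices of a `C²` function of `(t, x)` are continuous. [folklore] -/
theorem continuous_slice_snd (hψ : ContDiff ℝ 2 (Function.uncurry ψ)) (t : ℝ) :
    Continuous (ψ t) :=
  hψ.continuous.comp (Continuous.prodMk_right t)

/-- The energy density at a fixed time is continuous in `x` (`V` continuous, `ψ ∈ C²`).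
[folklore] -/
theorem continuous_energyDensity_slice (hV : Continuous V) (hψ : ContDiff ℝ 2 (Function.uncurry ψ))
    (t : ℝ) : Continuous (fun x => energyDensity V ψ t x) := by
  unfold energyDensity
  exact (((continuous_deriv_slice_fst hψ t).pow 2).add ((continuous_deriv_slice_snd hψ t).pow 2)).add
    (hV.mul ((continuous_slice_snd hψ t).pow 2))

/-- The Bochner integral of the energy density is the real part of the total energy (both sides
vanish when the energy is infinite). [folklore] -/
theorem integral_energyDensity_eq_toReal (hV : Continuous V) (hV0 : ∀ x, 0 ≤ V x)
    (hψ : ContDiff ℝ 2 (Function.uncurry ψ)) (t : ℝ) :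
    ∫ x, energyDensity V ψ t x = (totalEnergy V ψ t).toReal :=
  integral_eq_lintegral_of_nonneg_ae (ae_of_all _ fun x => energyDensity_nonneg ψ t (hV0 x))
    (continuous_energyDensity_slice hV hψ t).aestronglyMeasurable

/-- **The trivial partner `φ = ψ`, pairing**: the self-pairing density is the energy density, so
`∫ (ψ_t² + ψ_x² + Vψ²)(t, ·) = (E(ψ)(t)).toReal`. [folklore] -/
theorem integral_pairing_self (hV : Continuous V) (hV0 : ∀ x, 0 ≤ V x)
    (hψ : ContDiff ℝ 2 (Function.uncurry ψ)) (t : ℝ) :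
    ∫ x, (deriv (fun τ => ψ τ x) t * deriv (fun τ => ψ τ x) t + deriv (ψ t) x * deriv (ψ t) x
        + V x * (ψ t x * ψ t x)) = (totalEnergy V ψ t).toReal := by
  rw [← integral_energyDensity_eq_toReal hV hV0 hψ t]
  refine integral_congr_ae (ae_of_all _ fun x => ?_)
  simp only [energyDensity]
  ring

/-! ### Time-odd functions at `t = 0` -/

/-- A time-odd function vanishes at `t = 0`. [folklore] -/
theorem odd_slice_zero (hodd : ∀ t x, ψ (-t) x = -ψ t x) (x : ℝ) : ψ 0 x = 0 := by
  have h := hodd 0 x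
  rw [neg_zero] at h
  linarith

/-- Hence its `x`-derivative vanishes at `t = 0`. [folklore] -/
theorem odd_deriv_snd_zero (hodd : ∀ t x, ψ (-t) x = -ψ t x) (x : ℝ) : deriv (ψ 0) x = 0 := by
  rw [show ψ 0 = fun _ => (0 : ℝ) from funext (odd_slice_zero hodd), deriv_const]

/-- The energy density of a time-odd function at `t = 0` is `ψ_t(0, x)²`. [folklore] -/
theorem energyDensity_odd_zero (hodd : ∀ t x, ψ (-t) x = -ψ t x) (x : ℝ) :
    energyDensity V ψ 0 x = deriv (fun τ => ψ τ x) 0 ^ 2 := by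
  rw [energyDensity, odd_deriv_snd_zero hodd, odd_slice_zero hodd]
  ring

/-- The total energy of a time-odd function at `t = 0` is `∫⁻ ψ_t(0, ·)²`. [folklore] -/
theorem totalEnergy_odd_zero (hodd : ∀ t x, ψ (-t) x = -ψ t x) :
    totalEnergy V ψ 0 = ∫⁻ x, ENNReal.ofReal (deriv (fun τ => ψ τ x) 0 ^ 2) := by
  unfold totalEnergy
  exact lintegral_congr fun x => by rw [energyDensity_odd_zero hodd]

/-- For a time-odd function the support condition on the Cauchy data is a condition on the
velocity datum alone. [folklore] -/
theorem cauchyDataSupportedOn_odd_iff (hodd : ∀ t x, ψ (-t) x = -ψ t x) (S : Set ℝ) :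
    CauchyDataSupportedOn ψ S ↔ ∀ x ∉ S, deriv (fun τ => ψ τ x) 0 = 0 :=
  forall₂_congr fun x _ => by simp only [odd_slice_zero hodd x, true_and]

/-! ### Pairings with a time-odd solution -/

/-- **Pairing density with a time-odd function**: at `t = 0` only the kinetic term survives,
`(φ_t ψ_t + φ_x ψ_x + Vφψ)(0, x) = φ_t(0, x)·ψ_t(0, x)`, for ANY `φ`. [folklore] -/
theorem pairing_odd_eq (hodd : ∀ t x, ψ (-t) x = -ψ t x) (φ : ℝ → ℝ → ℝ) (x : ℝ) :
    deriv (fun τ => φ τ x) 0 * deriv (fun τ => ψ τ x) 0 + deriv (φ 0) x * deriv (ψ 0) x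
        + V x * (φ 0 x * ψ 0 x) = deriv (fun τ => φ τ x) 0 * deriv (fun τ => ψ τ x) 0 := by
  rw [odd_deriv_snd_zero hodd, odd_slice_zero hodd]
  ring

/-- Hence the energy pairing of any `φ` with a time-odd `ψ` at `t = 0` is `∫ φ_t(0, ·)·ψ_t(0, ·)`.
[folklore] -/
theorem integral_pairing_odd_eq (hodd : ∀ t x, ψ (-t) x = -ψ t x) (φ : ℝ → ℝ → ℝ) :
    ∫ x, (deriv (fun τ => φ τ x) 0 * deriv (fun τ => ψ τ x) 0 + deriv (φ 0) x * deriv (ψ 0) x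
        + V x * (φ 0 x * ψ 0 x))
      = ∫ x, deriv (fun τ => φ τ x) 0 * deriv (fun τ => ψ τ x) 0 :=
  integral_congr_ae (ae_of_all _ fun x => pairing_odd_eq hodd φ x)

/-! ### Velocity-matched partners: the pairing is automatic -/

/-- **Pairing density of a velocity-matched partner.** If `ψ` is time-odd and `φ_t(0, ·) = ψ_t(0, ·)`,
the pairing density of `φ` and `ψ` at `t = 0` equals the energy density of `ψ` pointwise (whatever
the position profile `φ(0, ·)`). [folklore] -/
theorem pairing_eq_energyDensity_of_velocity (hodd : ∀ t x, ψ (-t) x = -ψ t x)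
    (hv : ∀ x, deriv (fun τ => φ τ x) 0 = deriv (fun τ => ψ τ x) 0) (x : ℝ) :
    deriv (fun τ => φ τ x) 0 * deriv (fun τ => ψ τ x) 0 + deriv (φ 0) x * deriv (ψ 0) x
        + V x * (φ 0 x * ψ 0 x) = energyDensity V ψ 0 x := by
  rw [hv x, odd_deriv_snd_zero hodd, odd_slice_zero hodd, energyDensity_odd_zero hodd]
  ring

/-- **The pairing condition of `stub_escapeOdd` is automatic**: for `ψ ∈ C²` time-odd and any `φ`
with `φ_t(0, ·) = ψ_t(0, ·)`, `∫ (φ_t ψ_t + φ_x ψ_x + Vφψ)(0, ·) = (E(ψ)(0)).toReal`. [folklore] -/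
theorem integral_pairing_of_velocity (hV : Continuous V) (hV0 : ∀ x, 0 ≤ V x)
    (hψ : ContDiff ℝ 2 (Function.uncurry ψ)) (hodd : ∀ t x, ψ (-t) x = -ψ t x)
    (hv : ∀ x, deriv (fun τ => φ τ x) 0 = deriv (fun τ => ψ τ x) 0) :
    ∫ x, (deriv (fun τ => φ τ x) 0 * deriv (fun τ => ψ τ x) 0 + deriv (φ 0) x * deriv (ψ 0) x
        + V x * (φ 0 x * ψ 0 x)) = (totalEnergy V ψ 0).toReal := by
  rw [← integral_energyDensity_eq_toReal hV hV0 hψ 0]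
  exact integral_congr_ae (ae_of_all _ fun x => pairing_eq_energyDensity_of_velocity hodd hv x)

/-! ### Energy of the partner datum `(φ₀, g)` -/

/-- The energy density of data `(φ₀, g)`: `e[φ](0, x) = g² + φ₀′² + Vφ₀²`. [folklore] -/
theorem energyDensity_of_data {φ₀ g : ℝ → ℝ} (h0 : ∀ x, φ 0 x = φ₀ x)
    (h1 : ∀ x, deriv (fun τ => φ τ x) 0 = g x) (x : ℝ) :
    energyDensity V φ 0 x = g x ^ 2 + (deriv φ₀ x ^ 2 + V x * φ₀ x ^ 2) := by
  rw [energyDensity, h1 x, show φ 0 = φ₀ from funext h0]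
  ring

/-- The total energy of data `(φ₀, g)`: `E(φ)(0) = ∫⁻ (g² + φ₀′² + Vφ₀²)`. [folklore] -/
theorem totalEnergy_of_data {φ₀ g : ℝ → ℝ} (h0 : ∀ x, φ 0 x = φ₀ x)
    (h1 : ∀ x, deriv (fun τ => φ τ x) 0 = g x) :
    totalEnergy V φ 0 = ∫⁻ x, ENNReal.ofReal (g x ^ 2 + (deriv φ₀ x ^ 2 + V x * φ₀ x ^ 2)) := by
  unfold totalEnergy
  exact lintegral_congr fun x => by rw [energyDensity_of_data h0 h1]

/-- **Energy splitting of a velocity-matched partner**: for `ψ ∈ C²` time-odd (`g = ψ_t(0, ·)`),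
`V ≥ 0`, and `φ` with data `(φ₀, g)`: `E(φ)(0) = E(ψ)(0) + ∫⁻ (φ₀′² + Vφ₀²)`. [folklore] -/
theorem totalEnergy_partner_eq (hV0 : ∀ x, 0 ≤ V x) (hψ : ContDiff ℝ 2 (Function.uncurry ψ))
    (hodd : ∀ t x, ψ (-t) x = -ψ t x) {φ₀ : ℝ → ℝ} (h0 : ∀ x, φ 0 x = φ₀ x)
    (hv : ∀ x, deriv (fun τ => φ τ x) 0 = deriv (fun τ => ψ τ x) 0) :
    totalEnergy V φ 0
      = totalEnergy V ψ 0 + ∫⁻ x, ENNReal.ofReal (deriv φ₀ x ^ 2 + V x * φ₀ x ^ 2) := by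
  have hmeas : Measurable fun x => ENNReal.ofReal (deriv (fun τ => ψ τ x) 0 ^ 2) :=
    ENNReal.measurable_ofReal.comp ((continuous_deriv_slice_fst hψ 0).pow 2).measurable
  rw [totalEnergy_of_data h0 hv, totalEnergy_odd_zero hodd, ← lintegral_add_left hmeas]
  refine lintegral_congr fun x => ?_
  rw [ENNReal.ofReal_add (sq_nonneg _) (add_nonneg (sq_nonneg _) (mul_nonneg (hV0 x) (sq_nonneg _)))]

/-! ### Existence of velocity-matched Regge–Wheeler partners -/

section ReggeWheeler

variable {M : ℝ} {r : ℝ → ℝ} {xc : ℝ} {s ℓ : ℕ}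

/-- **Partners with prescribed position profile exist**: along a tortoise radius function, `s ≤ ℓ`,
for a global Regge–Wheeler solution `ψ` and any `φ₀ ∈ C²` there is a global Regge–Wheeler solution
`φ` with data `(φ₀, ψ_t(0, ·))` (unique by `CauchyWaveGlobal.solution_unique`). [folklore] -/
theorem partner_exists (hr : IsTortoiseRadius M r xc) (hsℓ : s ≤ ℓ) (hψ : IsRWSolution M s ℓ r ψ)
    {φ₀ : ℝ → ℝ} (hφ₀ : ContDiff ℝ 2 φ₀) :
    ∃ φ : ℝ → ℝ → ℝ, IsRWSolution M s ℓ r φ ∧ (∀ x, φ 0 x = φ₀ x) ∧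
      ∀ x, deriv (fun τ => φ τ x) 0 = deriv (fun τ => ψ τ x) 0 :=
  CauchyWaveGlobal.stub_rwGlobalCauchy M r xc hr s ℓ hsℓ φ₀ (fun x => deriv (fun τ => ψ τ x) 0) hφ₀
    (contDiff_one_deriv_slice_fst hψ.1 0)

/-- **The odd partner package.** Along a tortoise radius function, `s ≤ ℓ`, for a time-ODD global
Regge–Wheeler solution `ψ` (`g = ψ_t(0, ·)`) and any profile `φ₀ ∈ C²`, the Regge–Wheeler solution
`φ` with data `(φ₀, g)` exists, its energy pairing with `ψ` at `t = 0` is `(E(ψ)(0)).toReal`, and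
`E(φ)(0) = E(ψ)(0) + ∫⁻ (φ₀′² + V_{s,ℓ}φ₀²)`. [folklore] -/
theorem oddPartner_exists (hr : IsTortoiseRadius M r xc) (hsℓ : s ≤ ℓ)
    (hψ : IsRWSolution M s ℓ r ψ) (hodd : ∀ t x, ψ (-t) x = -ψ t x)
    {φ₀ : ℝ → ℝ} (hφ₀ : ContDiff ℝ 2 φ₀) :
    ∃ φ : ℝ → ℝ → ℝ, IsRWSolution M s ℓ r φ ∧ (∀ x, φ 0 x = φ₀ x) ∧
      (∀ x, deriv (fun τ => φ τ x) 0 = deriv (fun τ => ψ τ x) 0) ∧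
      (∫ x, (deriv (fun τ => φ τ x) 0 * deriv (fun τ => ψ τ x) 0 + deriv (φ 0) x * deriv (ψ 0) x
          + linePotential M s ℓ r x * (φ 0 x * ψ 0 x)))
        = (totalEnergy (linePotential M s ℓ r) ψ 0).toReal ∧
      totalEnergy (linePotential M s ℓ r) φ 0
        = totalEnergy (linePotential M s ℓ r) ψ 0
          + ∫⁻ x, ENNReal.ofReal (deriv φ₀ x ^ 2 + linePotential M s ℓ r x * φ₀ x ^ 2) := by
  have hV : Continuous (linePotential M s ℓ r) := (RW.differentiable_linePotential hr s ℓ).continuous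
  have hV0 : ∀ x, 0 ≤ linePotential M s ℓ r x := fun x => (RW.linePotential_pos hr hsℓ x).le
  obtain ⟨φ, hφ, h0, hv⟩ := partner_exists hr hsℓ hψ hφ₀
  exact ⟨φ, hφ, h0, hv, integral_pairing_of_velocity hV hV0 hψ.1 hodd hv,
    totalEnergy_partner_eq hV0 hψ.1 hodd h0 hv⟩

end ReggeWheeler

/-! ### The trivial partner: escape ⟸ core -/

/-- `√(1 − c) < 1` for `0 < c`. [folklore] -/
theorem sqrt_one_sub_lt_one {c : ℝ} (hc : 0 < c) : Real.sqrt (1 - c) < 1 :=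
  (Real.sqrt_lt' one_pos).2 (by rw [one_pow]; linarith)

/-- **The trivial partner.** If a finite-energy `ψ ∈ C²` (`V ≥ 0` continuous) obeys the forward
windowed inequality `c·E(ψ)(0) ≤ caught⁺_b(ψ)` with `0 < c ≤ 1`, then `φ := ψ` meets the three
partner conditions of the escape stubs with `A = 1`, `θ = √(1 − c)`. [folklore] -/
theorem escape_self (hV : Continuous V) (hV0 : ∀ x, 0 ≤ V x)
    (hψ : ContDiff ℝ 2 (Function.uncurry ψ)) {c b : ℝ} (hc0 : 0 ≤ c) (hc1 : c ≤ 1)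
    (hcore : ENNReal.ofReal c * totalEnergy V ψ 0 ≤ channelEnergy V 0 b ψ atTop) :
    (∫ x, (deriv (fun τ => ψ τ x) 0 * deriv (fun τ => ψ τ x) 0 + deriv (ψ 0) x * deriv (ψ 0) x
        + V x * (ψ 0 x * ψ 0 x))) = (totalEnergy V ψ 0).toReal ∧
    totalEnergy V ψ 0 ≤ ENNReal.ofReal 1 * totalEnergy V ψ 0 ∧
    totalEnergy V ψ 0 ≤ channelEnergy V 0 b ψ atTop
      + ENNReal.ofReal (Real.sqrt (1 - c) ^ 2) * totalEnergy V ψ 0 := by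
  refine ⟨integral_pairing_self hV hV0 hψ 0, by rw [ENNReal.ofReal_one, one_mul], ?_⟩
  rw [Real.sq_sqrt (by linarith)]
  calc totalEnergy V ψ 0
      = ENNReal.ofReal c * totalEnergy V ψ 0 + ENNReal.ofReal (1 - c) * totalEnergy V ψ 0 := by
        rw [← add_mul, ← ENNReal.ofReal_add hc0 (by linarith), add_sub_cancel, ENNReal.ofReal_one,
          one_mul]
    _ ≤ channelEnergy V 0 b ψ atTop + ENNReal.ofReal (1 - c) * totalEnergy V ψ 0 :=
        add_le_add hcore le_rfl

/-- **Escape ⟸ core** (converse of the skeleton's glue `core_of_duality_escape`, for ANY side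
condition `P` in place of the parity): a windowed inequality `c·E ≤ caught⁺_{ρ−h}` uniform in
`s ≤ 2 ≤ …`, `ℓ ≥ s` gives the partner statement with `φ = ψ`, `A = 1`, `θ = √(1 − min c 1)`.  Hence
the escape stubs of line `SketchIdeator3` are equivalent to the parity-pure cores. [folklore] -/
theorem escape_of_core (P : ℕ → ℕ → (ℝ → ℝ → ℝ) → Prop)
    (hcore : ∀ ρ : ℝ, 0 < ρ → ∃ h : ℝ, 0 ≤ h ∧ ∃ c : ℝ, 0 < c ∧
      ∀ (s ℓ : ℕ), s ≤ 2 → s ≤ ℓ → ∀ ψ : ℝ → ℝ → ℝ,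
        IsRWSolution 1 s ℓ (tortoiseRadius one_pos 0) ψ → P s ℓ ψ →
        CauchyDataSupportedOn ψ {x : ℝ | ρ < |x|} →
        totalEnergy (linePotential 1 s ℓ (tortoiseRadius one_pos 0)) ψ 0 ≠ ⊤ →
          ENNReal.ofReal c * totalEnergy (linePotential 1 s ℓ (tortoiseRadius one_pos 0)) ψ 0 ≤
            channelEnergy (linePotential 1 s ℓ (tortoiseRadius one_pos 0)) 0 (ρ - h) ψ atTop) :
    ∀ ρ : ℝ, 0 < ρ → ∃ h : ℝ, 0 ≤ h ∧ ∃ A : ℝ, 0 < A ∧ ∃ θ : ℝ, 0 ≤ θ ∧ θ < 1 ∧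
      ∀ (s ℓ : ℕ), s ≤ 2 → s ≤ ℓ → ∀ ψ : ℝ → ℝ → ℝ,
        IsRWSolution 1 s ℓ (tortoiseRadius one_pos 0) ψ → P s ℓ ψ →
        CauchyDataSupportedOn ψ {x : ℝ | ρ < |x|} →
        totalEnergy (linePotential 1 s ℓ (tortoiseRadius one_pos 0)) ψ 0 ≠ ⊤ →
        ∃ φ : ℝ → ℝ → ℝ, IsRWSolution 1 s ℓ (tortoiseRadius one_pos 0) φ ∧
          totalEnergy (linePotential 1 s ℓ (tortoiseRadius one_pos 0)) φ 0 ≠ ⊤ ∧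
          (∫ x, (deriv (fun τ => φ τ x) 0 * deriv (fun τ => ψ τ x) 0 + deriv (φ 0) x * deriv (ψ 0) x
              + linePotential 1 s ℓ (tortoiseRadius one_pos 0) x * (φ 0 x * ψ 0 x)))
            = (totalEnergy (linePotential 1 s ℓ (tortoiseRadius one_pos 0)) ψ 0).toReal ∧
          totalEnergy (linePotential 1 s ℓ (tortoiseRadius one_pos 0)) φ 0 ≤
            ENNReal.ofReal A * totalEnergy (linePotential 1 s ℓ (tortoiseRadius one_pos 0)) ψ 0 ∧
          totalEnergy (linePotential 1 s ℓ (tortoiseRadius one_pos 0)) φ 0 ≤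
            channelEnergy (linePotential 1 s ℓ (tortoiseRadius one_pos 0)) 0 (ρ - h) φ atTop +
              ENNReal.ofReal (θ ^ 2) * totalEnergy (linePotential 1 s ℓ (tortoiseRadius one_pos 0)) ψ 0 := by
  intro ρ hρ
  obtain ⟨h, hh, c, hc, H⟩ := hcore ρ hρ
  have hr := isTortoiseRadius_tortoiseRadius one_pos (0 : ℝ)
  refine ⟨h, hh, 1, one_pos, Real.sqrt (1 - min c 1), Real.sqrt_nonneg _,
    sqrt_one_sub_lt_one (lt_min hc one_pos), fun s ℓ hs hsℓ ψ hψ hP hsupp hE => ⟨ψ, hψ, hE, ?_⟩⟩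
  refine escape_self (RW.differentiable_linePotential hr s ℓ).continuous
    (fun x => (RW.linePotential_pos hr hsℓ x).le) hψ.1 (le_min hc.le zero_le_one) (min_le_right _ _)
    ((mul_le_mul' (ENNReal.ofReal_le_ofReal (min_le_left _ _)) le_rfl).trans
      (H s ℓ hs hsℓ ψ hψ hP hsupp hE))

/-! ### The profile form of `stub_escapeOdd` -/

/-- **`stub_escapeOdd` from its profile form.**  Since the pairing is automatic and the energy of a
velocity-matched partner splits as `E(ψ) + ∫⁻ (φ(0)′² + Vφ(0)²)`, the odd escape statement follows
from: for every shell half-width `ρ > 0` there are `h ≥ 0`, `A ≥ 0`, `θ ∈ [0, 1)` such that every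
admissible odd `ψ` has a VELOCITY-MATCHED Regge–Wheeler solution `φ` (`φ_t(0, ·) = ψ_t(0, ·)`; one
exists for every `C²` position profile, `partner_exists`) whose position profile has static energy
`∫⁻ (φ(0)′² + Vφ(0)²) ≤ A·E(ψ)` and which loses at most `θ²E(ψ)` behind the lagged cone; the
constants become `h`, `A + 1`, `θ`. [folklore] -/
theorem escapeOdd_of_velocityMatched
    (hprof : ∀ ρ : ℝ, 0 < ρ → ∃ h : ℝ, 0 ≤ h ∧ ∃ A : ℝ, 0 ≤ A ∧ ∃ θ : ℝ, 0 ≤ θ ∧ θ < 1 ∧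
      ∀ (s ℓ : ℕ), s ≤ 2 → s ≤ ℓ → ∀ ψ : ℝ → ℝ → ℝ,
        IsRWSolution 1 s ℓ (tortoiseRadius one_pos 0) ψ → (∀ t x, ψ (-t) x = -ψ t x) →
        CauchyDataSupportedOn ψ {x : ℝ | ρ < |x|} →
        totalEnergy (linePotential 1 s ℓ (tortoiseRadius one_pos 0)) ψ 0 ≠ ⊤ →
        ∃ φ : ℝ → ℝ → ℝ, IsRWSolution 1 s ℓ (tortoiseRadius one_pos 0) φ ∧
          (∀ x, deriv (fun τ => φ τ x) 0 = deriv (fun τ => ψ τ x) 0) ∧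
          (∫⁻ x, ENNReal.ofReal (deriv (φ 0) x ^ 2
              + linePotential 1 s ℓ (tortoiseRadius one_pos 0) x * φ 0 x ^ 2))
            ≤ ENNReal.ofReal A * totalEnergy (linePotential 1 s ℓ (tortoiseRadius one_pos 0)) ψ 0 ∧
          totalEnergy (linePotential 1 s ℓ (tortoiseRadius one_pos 0)) φ 0 ≤
            channelEnergy (linePotential 1 s ℓ (tortoiseRadius one_pos 0)) 0 (ρ - h) φ atTop +
              ENNReal.ofReal (θ ^ 2)
                * totalEnergy (linePotential 1 s ℓ (tortoiseRadius one_pos 0)) ψ 0) :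
    ∀ ρ : ℝ, 0 < ρ → ∃ h : ℝ, 0 ≤ h ∧ ∃ A : ℝ, 0 < A ∧ ∃ θ : ℝ, 0 ≤ θ ∧ θ < 1 ∧
      ∀ (s ℓ : ℕ), s ≤ 2 → s ≤ ℓ → ∀ ψ : ℝ → ℝ → ℝ,
        IsRWSolution 1 s ℓ (tortoiseRadius one_pos 0) ψ → (∀ t x, ψ (-t) x = -ψ t x) →
        CauchyDataSupportedOn ψ {x : ℝ | ρ < |x|} →
        totalEnergy (linePotential 1 s ℓ (tortoiseRadius one_pos 0)) ψ 0 ≠ ⊤ →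
        ∃ φ : ℝ → ℝ → ℝ, IsRWSolution 1 s ℓ (tortoiseRadius one_pos 0) φ ∧
          totalEnergy (linePotential 1 s ℓ (tortoiseRadius one_pos 0)) φ 0 ≠ ⊤ ∧
          (∫ x, (deriv (fun τ => φ τ x) 0 * deriv (fun τ => ψ τ x) 0 + deriv (φ 0) x * deriv (ψ 0) x
              + linePotential 1 s ℓ (tortoiseRadius one_pos 0) x * (φ 0 x * ψ 0 x)))
            = (totalEnergy (linePotential 1 s ℓ (tortoiseRadius one_pos 0)) ψ 0).toReal ∧
          totalEnergy (linePotential 1 s ℓ (tortoiseRadius one_pos 0)) φ 0 ≤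
            ENNReal.ofReal A * totalEnergy (linePotential 1 s ℓ (tortoiseRadius one_pos 0)) ψ 0 ∧
          totalEnergy (linePotential 1 s ℓ (tortoiseRadius one_pos 0)) φ 0 ≤
            channelEnergy (linePotential 1 s ℓ (tortoiseRadius one_pos 0)) 0 (ρ - h) φ atTop +
              ENNReal.ofReal (θ ^ 2) * totalEnergy (linePotential 1 s ℓ (tortoiseRadius one_pos 0)) ψ 0 := by
  intro ρ hρ
  obtain ⟨h, hh, A, hA, θ, hθ0, hθ1, H⟩ := hprof ρ hρ
  have hr := isTortoiseRadius_tortoiseRadius one_pos (0 : ℝ)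
  refine ⟨h, hh, A + 1, by positivity, θ, hθ0, hθ1, fun s ℓ hs hsℓ ψ hψ hodd hsupp hE => ?_⟩
  obtain ⟨φ, hφ, hv, hS, hloss⟩ := H s ℓ hs hsℓ ψ hψ hodd hsupp hE
  have hV : Continuous (linePotential 1 s ℓ (tortoiseRadius one_pos 0)) :=
    (RW.differentiable_linePotential hr s ℓ).continuous
  have hV0 : ∀ x, 0 ≤ linePotential 1 s ℓ (tortoiseRadius one_pos 0) x := fun x =>
    (RW.linePotential_pos hr hsℓ x).le
  have hEφ := totalEnergy_partner_eq hV0 hψ.1 hodd (φ := φ) (φ₀ := φ 0) (fun x => rfl) hv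
  have hSfin : (∫⁻ x, ENNReal.ofReal (deriv (φ 0) x ^ 2
      + linePotential 1 s ℓ (tortoiseRadius one_pos 0) x * φ 0 x ^ 2)) ≠ ⊤ :=
    (hS.trans_lt (ENNReal.mul_lt_top ENNReal.ofReal_lt_top hE.lt_top)).ne
  refine ⟨φ, hφ, ?_, integral_pairing_of_velocity hV hV0 hψ.1 hodd hv, ?_, hloss⟩
  · rw [hEφ]
    exact ENNReal.add_ne_top.2 ⟨hE, hSfin⟩
  · rw [hEφ]
    calc totalEnergy (linePotential 1 s ℓ (tortoiseRadius one_pos 0)) ψ 0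
          + ∫⁻ x, ENNReal.ofReal (deriv (φ 0) x ^ 2
              + linePotential 1 s ℓ (tortoiseRadius one_pos 0) x * φ 0 x ^ 2)
        ≤ totalEnergy (linePotential 1 s ℓ (tortoiseRadius one_pos 0)) ψ 0
          + ENNReal.ofReal A * totalEnergy (linePotential 1 s ℓ (tortoiseRadius one_pos 0)) ψ 0 :=
          add_le_add le_rfl hS
      _ = ENNReal.ofReal (A + 1) * totalEnergy (linePotential 1 s ℓ (tortoiseRadius one_pos 0)) ψ 0 := by
          rw [ENNReal.ofReal_add hA zero_le_one, ENNReal.ofReal_one, add_mul, one_mul, add_comm]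

end EscapeOdd

/-- **Registered stub `stub_oddPartner`** (crux `WindowedShellChannels`, line `SketchIdeator3`, serving
`stub_escapeOdd`): the odd partner package `EscapeOdd.oddPartner_exists` — along a tortoise radius
function, `s ≤ ℓ`, for a time-odd global Regge–Wheeler solution `ψ` and any profile `φ₀ ∈ C²` the
Regge–Wheeler solution with data `(φ₀, ψ_t(0, ·))` exists, pairs with `ψ` to `(E(ψ)(0)).toReal`, and
has energy `E(ψ)(0) + ∫⁻ (φ₀′² + V_{s,ℓ}φ₀²)`. [folklore] -/
theorem stub_oddPartner : ∀ (M : ℝ) (r : ℝ → ℝ) (xc : ℝ), IsTortoiseRadius M r xc → ∀ (s ℓ : ℕ), s ≤ ℓ → ∀ ψ : ℝ → ℝ → ℝ, IsRWSolution M s ℓ r ψ → (∀ t x, ψ (-t) x = -ψ t x) → ∀ φ₀ : ℝ → ℝ, ContDiff ℝ 2 φ₀ → ∃ φ : ℝ → ℝ → ℝ, IsRWSolution M s ℓ r φ ∧ (∀ x, φ 0 x = φ₀ x) ∧ (∀ x, deriv (fun τ => φ τ x) 0 = deriv (fun τ => ψ τ x) 0) ∧ (∫ x, (deriv (fun τ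 => φ τ x) 0 * deriv (fun τ => ψ τ x) 0 + deriv (φ 0) x * deriv (ψ 0) x + linePotential M s ℓ r x * (φ 0 x * ψ 0 x))) = (totalEnergy (linePotential M s ℓ r) ψ 0).toReal ∧ totalEnergy (linePotential M s ℓ r) φ 0 = totalEnergy (linePotential M s ℓ r) ψ 0 + ∫⁻ x, ENNReal.ofReal (deriv φ₀ x ^ 2 + linePotential M s ℓ r x * φ₀ x ^ 2) :=
  fun _ _ _ hr _ _ hsℓ _ hψ hodd _ hφ₀ => EscapeOdd.oddPartner_exists hr hsℓ hψ hodd hφ₀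

end Summit.FinalStateConjecture.FinalStateConjecture.Theorems.WindowedShellChannelsStubs

end
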